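import Summits.Ventures.PercRepro.S2SquareMultiplicity

/-!
# PercRepro — THE TRIPLE MULTIPLICITY: a rank-`q` `m`-set lies in the fibre of at least `ν(3ν − 1)/2` pairs (p8 g4, S3)

`proofs/SUBCLAIM-S3-p8.md` §3q. p7's SQUARE (`S2.card_spanF_ge_sq`, S2SquareMultiplicity): a rank-`q` set `B` with
`m = q + ν` elements has at least `ν + 2·C(ν, 2) = ν²` spanning `(q+1)`-subsets — the sets `I ∪ {x}` and, for every
pair `{x, y} ⊆ B ∖ I` and every `z ∈ I` on the fundamental circuit of `x` OR of `y`, the set `(I ∖ {z}) ∪ {x, y}`; p7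
charged TWO such `z` per pair (one circuit, `≥ 3` elements). UNDER THE LINE BOUND (every rank-`2` set of `M` has `≤ 3`
points — the `e`-free core) there are THREE: if both fundamental circuits met `I` in the same two elements `a, b`, the
circuits would be the triangles `{x, a, b}` and `{y, a, b}` and `{a, b, x, y}` a 4-point line
(`three_le_card_filter_fundCircuit_pair`). Hence `ν + 3·C(ν, 2) = ν(3ν − 1)/2` spanning `(q+1)`-subsets
(`card_spanF_ge_tri`, stated as `ν(3ν − 1) ≤ 2·#spanF`): `1, 5, 12, 22, 35, 51, …` against `1, 4, 9, 16, 25, 36, …`,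
and the fibre weights of the heavy / light count become `2/((j + 1)(3j + 2))` in place of `1/(j + 1)²`
(RankLevelSetTripleMultCount). `card_pairs_ge_tri` carries it to the pairs of the split count, word for word as p7's
`card_pairs_ge_sq`. Axioms: standard.
-/

open scoped Matroid

namespace PercRepro

namespace S2

open Set Finset

variable {α : Type} {M : Matroid α}

open scoped Classical in
/-- **THE LINE BOUND PUTS THREE BASIS ELEMENTS ON THE TWO FUNDAMENTAL CIRCUITS OF A PAIR**: for `x ≠ y` in the closure
of an independent set `I`, outside `I`, the elements of `I` on `C(x, I)` or on `C(y, I)` number at least `3` when every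
rank-`2` set has `≤ 3` points (otherwise `C(x, I) = {x, a, b}`, `C(y, I) = {y, a, b}` and `{a, b, x, y}` is a 4-point
line). -/
theorem three_le_card_filter_fundCircuit_pair [M.Finite] (hcirc : ∀ C, M.IsCircuit C → 3 ≤ C.encard)
    (hline : ∀ L ⊆ M.E, M.eRk L = 2 → L.ncard ≤ 3)
    {I : Finset α} (hI : M.Indep (I : Set α)) {x y : α} (hxcl : x ∈ M.closure (I : Set α)) (hxI : x ∉ I)
    (hycl : y ∈ M.closure (I : Set α)) (hyI : y ∉ I) (hxy : x ≠ y) :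
    3 ≤ (I.filter (fun z => z ∈ M.fundCircuit x (I : Set α) ∨ z ∈ M.fundCircuit y (I : Set α))).card := by
  classical
  set Sx := I.filter (fun z => z ∈ M.fundCircuit x (I : Set α)) with hSx
  set Sy := I.filter (fun z => z ∈ M.fundCircuit y (I : Set α)) with hSy
  have hunion : I.filter (fun z => z ∈ M.fundCircuit x (I : Set α) ∨ z ∈ M.fundCircuit y (I : Set α)) = Sx ∪ Sy := by
    rw [hSx, hSy, Finset.filter_or]
  rw [hunion]
  have hx2 : 2 ≤ Sx.card := two_le_card_filter_fundCircuit hcirc hI hxcl hxI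
  have hy2 : 2 ≤ Sy.card := two_le_card_filter_fundCircuit hcirc hI hycl hyI
  by_contra hlt
  push Not at hlt
  -- then `Sx = Sy = {a, b}`
  have hSxU : Sx = Sx ∪ Sy := by
    apply Finset.eq_of_subset_of_card_le Finset.subset_union_left
    omega
  have hSyU : Sy = Sx ∪ Sy := by
    apply Finset.eq_of_subset_of_card_le Finset.subset_union_right
    omega
  have hSxy : Sx = Sy := by rw [hSxU, ← hSyU]
  have hSxc : Sx.card = (Sx ∪ Sy).card := by rw [← hSxU]
  have hSx2 : Sx.card = 2 := by omega
  obtain ⟨a, b, hab, hSxab⟩ := Finset.card_eq_two.1 hSx2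
  have haI : a ∈ I := by
    have : a ∈ Sx := by rw [hSxab]; exact Finset.mem_insert_self a _
    exact (Finset.mem_filter.1 this).1
  have hbI : b ∈ I := by
    have : b ∈ Sx := by rw [hSxab]; exact Finset.mem_insert_of_mem (Finset.mem_singleton_self b)
    exact (Finset.mem_filter.1 this).1
  -- the circuit of `x` is `{x, a, b}`: `x ∈ cl {a, b}`
  have hcl_of : ∀ (w : α) (S : Finset α), w ∈ M.closure (I : Set α) → w ∉ I →
      S = I.filter (fun z => z ∈ M.fundCircuit w (I : Set α)) → S = {a, b} → w ∈ M.closure {a, b} := by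
    intro w S hwcl hwI hS hSab
    have hC : M.IsCircuit (M.fundCircuit w (I : Set α)) :=
      hI.fundCircuit_isCircuit hwcl (by simpa using hwI)
    have hCsub : M.fundCircuit w (I : Set α) ⊆ insert w (I : Set α) := M.fundCircuit_subset_insert w _
    have hwC : w ∈ M.fundCircuit w (I : Set α) := M.mem_fundCircuit w _
    have hdiff : M.fundCircuit w (I : Set α) \ {w} ⊆ ({a, b} : Set α) := by
      intro z hz
      have hzC : z ∈ M.fundCircuit w (I : Set α) := hz.1
      have hzw : z ≠ w := by simpa using hz.2
      have hzI : z ∈ I := by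
        rcases hCsub hzC with h | h
        · exact absurd h hzw
        · exact_mod_cast h
      have hzS : z ∈ S := by rw [hS, Finset.mem_filter]; exact ⟨hzI, hzC⟩
      rw [hSab] at hzS
      simp only [Finset.mem_insert, Finset.mem_singleton] at hzS
      rcases hzS with h | h
      · rw [h]; exact Set.mem_insert a _
      · rw [h]; exact Set.mem_insert_of_mem a (Set.mem_singleton b)
    have h1 : w ∈ M.closure (M.fundCircuit w (I : Set α) \ {w}) := hC.mem_closure_sdiff_singleton_of_mem hwC
    exact M.closure_subset_closure hdiff h1
  have hxab : x ∈ M.closure {a, b} := hcl_of x Sx hxcl hxI rfl hSxab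
  have hyab : y ∈ M.closure {a, b} := hcl_of y Sy hycl hyI rfl (by rw [← hSxy]; exact hSxab)
  -- `{a, b, x, y}` is a 4-point set of rank `2`
  have habI : ({a, b} : Set α) ⊆ (I : Set α) := by
    intro z hz
    rcases hz with h | h
    · rw [h]; exact_mod_cast haI
    · rw [Set.mem_singleton_iff.1 h]; exact_mod_cast hbI
  have habind : M.Indep ({a, b} : Set α) := hI.subset habI
  have hab2 : M.eRk ({a, b} : Set α) = 2 := by
    rw [habind.eRk_eq_encard, Set.encard_pair hab]
  set L : Set α := {a, b, x, y} with hL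
  have hLsub : L ⊆ M.closure {a, b} := by
    intro z hz
    rcases hz with h | h | h | h
    · rw [h]; exact M.subset_closure _ (habind.subset_ground) (Set.mem_insert a _)
    · rw [h]; exact M.subset_closure _ (habind.subset_ground) (Set.mem_insert_of_mem a (Set.mem_singleton b))
    · rw [h]; exact hxab
    · rw [Set.mem_singleton_iff.1 h]; exact hyab
  have hLE : L ⊆ M.E := hLsub.trans (M.closure_subset_ground _)
  have hL2 : M.eRk L = 2 := by
    apply le_antisymm
    · calc M.eRk L ≤ M.eRk (M.closure {a, b}) := M.eRk_mono hLsub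
        _ = M.eRk {a, b} := M.eRk_closure_eq _
        _ = 2 := hab2
    · rw [← hab2]
      apply M.eRk_mono
      intro z hz
      rcases hz with h | h
      · rw [h]; exact Set.mem_insert a _
      · rw [Set.mem_singleton_iff.1 h]; exact Set.mem_insert_of_mem a (Set.mem_insert b _)
  have hxa : x ≠ a := fun h => hxI (h ▸ haI)
  have hxb : x ≠ b := fun h => hxI (h ▸ hbI)
  have hya : y ≠ a := fun h => hyI (h ▸ haI)
  have hyb : y ≠ b := fun h => hyI (h ▸ hbI)
  have hL4 : L.ncard = 4 := by
    rw [hL, Set.ncard_insert_of_notMem, Set.ncard_insert_of_notMem, Set.ncard_pair hxy]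
    · simp only [Set.mem_insert_iff, Set.mem_singleton_iff]
      push Not
      exact ⟨hxb.symm, hyb.symm⟩
    · simp only [Set.mem_insert_iff, Set.mem_singleton_iff]
      push Not
      exact ⟨hab, hxa.symm, hya.symm⟩
  have := hline L hLE hL2
  omega

/-- **THE TRIPLE**: a rank-`q` set `B` of `m = q + ν` elements (every circuit of `≥ 3` elements, every rank-`2` set of
`≤ 3` points) has at least `ν + 3·C(ν, 2) = ν(3ν − 1)/2` spanning `(q+1)`-subsets. -/
theorem card_spanF_ge_tri [M.Finite] (q : ℕ) (hq : 1 ≤ q) (hcirc : ∀ C, M.IsCircuit C → 3 ≤ C.encard)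
    (hline : ∀ L ⊆ M.E, M.eRk L = 2 → L.ncard ≤ 3)
    {B : Finset α} (hBE : (B : Set α) ⊆ M.E) (hBq : M.eRk (B : Set α) = (q : ℕ∞)) :
    (B.card - q) * (3 * (B.card - q) - 1) ≤ 2 * (spanF M q B).card := by
  classical
  obtain ⟨I₀, hI₀⟩ := M.exists_isBasis (B : Set α) hBE
  have hI₀fin : I₀.Finite := B.finite_toSet.subset hI₀.subset
  set I : Finset α := hI₀fin.toFinset with hIdef
  have hIcoe : (I : Set α) = I₀ := Set.Finite.coe_toFinset _
  have hIB : I ⊆ B := by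
    intro x hx
    rw [hIdef, Set.Finite.mem_toFinset] at hx
    exact_mod_cast hI₀.subset hx
  have hIcard : I.card = q := by
    have h := hI₀.encard_eq_eRk
    rw [hBq, ← hI₀fin.cast_ncard_eq] at h
    have h' : I₀.ncard = q := by exact_mod_cast h
    rw [hIdef, ← Set.ncard_eq_toFinset_card _ hI₀fin]; exact h'
  have hIind : M.Indep (I : Set α) := by rw [hIcoe]; exact hI₀.indep
  have hBcl : (B : Set α) ⊆ M.closure (I : Set α) := by rw [hIcoe]; exact hI₀.subset_closure
  set X : Finset α := B \ I with hXdef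
  have hXcard : X.card = B.card - q := by
    rw [hXdef, Finset.card_sdiff, Finset.inter_eq_left.2 hIB, hIcard]
  have hXI : ∀ x ∈ X, x ∉ I := fun x hx => (Finset.mem_sdiff.1 hx).2
  have hXB : ∀ x ∈ X, x ∈ B := fun x hx => (Finset.mem_sdiff.1 hx).1
  have hXcl : ∀ x ∈ X, x ∈ M.closure (I : Set α) := fun x hx => hBcl (by exact_mod_cast hXB x hx)
  -- FAMILY 1: `I ∪ {x}`, `x ∈ X`
  set F₁ : Finset (Set α) := X.image (fun x => ((insert x I : Finset α) : Set α)) with hF₁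
  have hF₁card : F₁.card = X.card := by
    rw [hF₁]
    apply Finset.card_image_of_injOn
    intro x hx y hy hxy
    have hxy'' : (insert x I : Finset α) = insert y I := by
      simp only at hxy
      exact Finset.coe_inj.1 hxy
    have hx' : x ∈ (insert y I : Finset α) := hxy'' ▸ Finset.mem_insert_self x I
    rcases Finset.mem_insert.1 hx' with h | h
    · exact h
    · exact absurd h (hXI x hx)
  have hF₁sub : F₁ ⊆ spanF M q B := by
    intro D hD
    rw [hF₁, Finset.mem_image] at hD
    obtain ⟨x, hx, rfl⟩ := hD
    rw [mem_spanF]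
    have hsubB : insert x I ⊆ B := Finset.insert_subset (hXB x hx) hIB
    have hcl : (B : Set α) ⊆ M.closure ((insert x I : Finset α) : Set α) := by
      refine hBcl.trans (M.closure_subset_closure ?_)
      rw [Finset.coe_insert]; exact Set.subset_insert x _
    refine ⟨insert x I, hsubB, ?_, ?_, hcl, rfl⟩
    · rw [Finset.card_insert_of_notMem (hXI x hx), hIcard]
    · exact eRk_eq_of_subset_of_subset_closure (by exact_mod_cast hsubB) hBq hcl
  -- FAMILY 2: `(I ∖ {z}) ∪ P`, `P` a pair of `X`, `z ∈ I` on the fundamental circuit of an element of `P`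
  set S : Finset (Σ _ : Finset α, α) :=
    (X.powersetCard 2).sigma (fun P => I.filter (fun z => ∃ x ∈ P, z ∈ M.fundCircuit x (I : Set α))) with hS
  set g : (Σ _ : Finset α, α) → Set α := fun s => ((s.1 ∪ I.erase s.2 : Finset α) : Set α) with hg
  set F₂ : Finset (Set α) := S.image g with hF₂
  have hSdata : ∀ s ∈ S, s.1 ⊆ X ∧ s.1.card = 2 ∧ s.2 ∈ I ∧
      ∃ x ∈ s.1, s.2 ∈ M.fundCircuit x (I : Set α) := by
    intro s hs
    rw [hS, Finset.mem_sigma, Finset.mem_powersetCard, Finset.mem_filter] at hs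
    exact ⟨hs.1.1, hs.1.2, hs.2.1, hs.2.2⟩
  -- `P ∪ I.erase z` determines `P = D ∖ I` and `z` = the element of `I` outside `D`
  have hsdiff : ∀ (P : Finset α) (z : α), P ⊆ X → (P ∪ I.erase z) \ I = P := by
    intro P z hPX
    ext a
    simp only [Finset.mem_sdiff, Finset.mem_union, Finset.mem_erase]
    constructor
    · rintro ⟨h1 | h1, h2⟩
      · exact h1
      · exact absurd h1.2 h2
    · intro ha
      exact ⟨Or.inl ha, hXI a (hPX ha)⟩
  have hinter : ∀ (P : Finset α) (z : α), P ⊆ X → (P ∪ I.erase z) ∩ I = I.erase z := by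
    intro P z hPX
    ext a
    simp only [Finset.mem_inter, Finset.mem_union, Finset.mem_erase]
    constructor
    · rintro ⟨h1 | h1, h2⟩
      · exact absurd h2 (hXI a (hPX h1))
      · exact h1
    · intro ha
      exact ⟨Or.inr ha, ha.2⟩
  have hF₂card : F₂.card = S.card := by
    rw [hF₂]
    apply Finset.card_image_of_injOn
    intro s hs s' hs' h
    obtain ⟨hP, -, hz, -⟩ := hSdata s (by exact_mod_cast hs)
    obtain ⟨hP', -, hz', -⟩ := hSdata s' (by exact_mod_cast hs')
    have h' : (s.1 ∪ I.erase s.2 : Finset α) = s'.1 ∪ I.erase s'.2 := by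
      have := h
      simp only [hg] at this
      exact_mod_cast this
    have hP1 : s.1 = s'.1 := by
      rw [← hsdiff s.1 s.2 hP, h', hsdiff s'.1 s'.2 hP']
    have hE : I.erase s.2 = I.erase s'.2 := by
      rw [← hinter s.1 s.2 hP, h', hinter s'.1 s'.2 hP']
    have hz1 : s.2 = s'.2 := by
      by_contra hne
      have hmem : s.2 ∈ I.erase s'.2 := Finset.mem_erase.2 ⟨hne, hz⟩
      rw [← hE] at hmem
      exact Finset.notMem_erase s.2 I hmem
    exact Sigma.ext hP1 (heq_of_eq hz1)
  have hF₂sub : F₂ ⊆ spanF M q B := by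
    intro D hD
    rw [hF₂, Finset.mem_image] at hD
    obtain ⟨s, hs, rfl⟩ := hD
    obtain ⟨hP, hP2, hz, x, hxP, hzC⟩ := hSdata s (by exact_mod_cast hs)
    have hxX : x ∈ X := hP hxP
    have hxI : x ∉ I := hXI x hxX
    have hxcl : x ∈ M.closure (I : Set α) := hXcl x hxX
    -- `z ∈ cl((I ∪ {x}) ∖ {z})`, so the closure of `(I ∪ {x}) ∖ {z}` is that of `I ∪ {x}`
    have hC : M.IsCircuit (M.fundCircuit x (I : Set α)) :=
      hIind.fundCircuit_isCircuit hxcl (by simpa using hxI)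
    have hCsub : M.fundCircuit x (I : Set α) ⊆ insert x (I : Set α) := M.fundCircuit_subset_insert x _
    have hzcl : s.2 ∈ M.closure ((insert x (I : Set α)) \ {s.2}) :=
      M.closure_subset_closure (Set.sdiff_subset_sdiff_left hCsub) (hC.mem_closure_sdiff_singleton_of_mem hzC)
    have hcleq : M.closure ((insert x (I : Set α)) \ {s.2}) = M.closure (insert x (I : Set α)) :=
      M.closure_sdiff_singleton_eq_closure hzcl
    have hsubD : (insert x (I : Set α)) \ {s.2} ⊆ ((s.1 ∪ I.erase s.2 : Finset α) : Set α) := by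
      intro a ha
      rw [Finset.coe_union, Finset.coe_erase]
      rcases ha.1 with h | h
      · exact Or.inl (by rw [h]; exact_mod_cast hxP)
      · exact Or.inr ⟨h, ha.2⟩
    have hcl : (B : Set α) ⊆ M.closure ((s.1 ∪ I.erase s.2 : Finset α) : Set α) := by
      calc (B : Set α) ⊆ M.closure (I : Set α) := hBcl
        _ ⊆ M.closure (insert x (I : Set α)) := M.closure_subset_closure (Set.subset_insert x _)
        _ = M.closure ((insert x (I : Set α)) \ {s.2}) := hcleq.symm
        _ ⊆ M.closure ((s.1 ∪ I.erase s.2 : Finset α) : Set α) := M.closure_subset_closure hsubD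
    have hsubB : s.1 ∪ I.erase s.2 ⊆ B :=
      Finset.union_subset (hP.trans (Finset.sdiff_subset)) ((Finset.erase_subset _ _).trans hIB)
    rw [mem_spanF]
    refine ⟨s.1 ∪ I.erase s.2, hsubB, ?_, ?_, hcl, rfl⟩
    · have hdisj : Disjoint s.1 (I.erase s.2) := by
        rw [Finset.disjoint_left]
        intro a ha ha'
        exact hXI a (hP ha) (Finset.mem_erase.1 ha').2
      rw [Finset.card_union_of_disjoint hdisj, hP2, Finset.card_erase_of_mem hz, hIcard]
      omega
    · exact eRk_eq_of_subset_of_subset_closure (by exact_mod_cast hsubB) hBq hcl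
  -- the two families are disjoint: family 1 contains `I`, family 2 misses `z ∈ I`
  have hdisj : Disjoint F₁ F₂ := by
    rw [Finset.disjoint_left]
    intro D hD1 hD2
    rw [hF₁, Finset.mem_image] at hD1
    rw [hF₂, Finset.mem_image] at hD2
    obtain ⟨x, hx, rfl⟩ := hD1
    obtain ⟨s, hs, hsD⟩ := hD2
    obtain ⟨hP, -, hz, -⟩ := hSdata s (by exact_mod_cast hs)
    have h' : (s.1 ∪ I.erase s.2 : Finset α) = insert x I := by
      have := hsD
      simp only [hg] at this
      exact_mod_cast this
    have hzmem : s.2 ∈ s.1 ∪ I.erase s.2 := by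
      rw [h']; exact Finset.mem_insert_of_mem hz
    rcases Finset.mem_union.1 hzmem with h | h
    · exact hXI _ (hP h) hz
    · exact Finset.notMem_erase s.2 I h
  -- counting: `#S ≥ 3·C(ν, 2)` — the two fundamental circuits of a pair meet `I` in `≥ 3` elements (the line bound)
  have hScard : 3 * (X.powersetCard 2).card ≤ S.card := by
    rw [hS, Finset.card_sigma]
    have : ∀ P ∈ X.powersetCard 2,
        3 ≤ (I.filter (fun z => ∃ x ∈ P, z ∈ M.fundCircuit x (I : Set α))).card := by
      intro P hP
      rw [Finset.mem_powersetCard] at hP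
      obtain ⟨x, y, hxy, hPxy⟩ := Finset.card_eq_two.1 hP.2
      have hxP : x ∈ P := by rw [hPxy]; exact Finset.mem_insert_self x _
      have hyP : y ∈ P := by rw [hPxy]; exact Finset.mem_insert_of_mem (Finset.mem_singleton_self y)
      have hxX : x ∈ X := hP.1 hxP
      have hyX : y ∈ X := hP.1 hyP
      have h3 := three_le_card_filter_fundCircuit_pair hcirc hline hIind (hXcl x hxX) (hXI x hxX)
        (hXcl y hyX) (hXI y hyX) hxy
      refine h3.trans (Finset.card_le_card ?_)
      intro z hz
      rw [Finset.mem_filter] at hz ⊢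
      rcases hz.2 with h | h
      · exact ⟨hz.1, x, hxP, h⟩
      · exact ⟨hz.1, y, hyP, h⟩
    calc 3 * (X.powersetCard 2).card = ∑ _P ∈ X.powersetCard 2, 3 := by
          simp [mul_comm]
      _ ≤ _ := Finset.sum_le_sum this
  have hpow : (X.powersetCard 2).card = X.card.choose 2 := Finset.card_powersetCard 2 X
  have hchoose : 2 * X.card.choose 2 = X.card * (X.card - 1) := by
    rw [Nat.choose_two_right]
    exact Nat.two_mul_div_two_of_even (Nat.even_mul_pred_self X.card)
  -- assemble
  have hunion : (F₁ ∪ F₂).card ≤ (spanF M q B).card :=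
    Finset.card_le_card (Finset.union_subset hF₁sub hF₂sub)
  rw [Finset.card_union_of_disjoint hdisj, hF₁card, hF₂card] at hunion
  rw [← hXcard]
  -- `ν(3ν − 1) = 2ν + 3·ν(ν − 1)`
  have hsq : X.card * (3 * X.card - 1) = 2 * X.card + 3 * (X.card * (X.card - 1)) := by
    cases h : X.card with
    | zero => rfl
    | succ k => rw [Nat.succ_sub_one, show 3 * (k + 1) - 1 = 3 * k + 2 by omega]; ring
  rw [hsq]
  omega


open scoped Classical in
/-- **The triple multiplicity of the pairs**: a rank-`q` set `B` of `m > q` elements lies in the level-`m` fibre of at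
least `(m − q)(3(m − q) − 1)/2` pairs (p7's `card_pairs_ge_sq` on `card_spanF_ge_tri`). -/
theorem card_pairs_ge_tri [M.Finite] (q : ℕ) (hq : 1 ≤ q) (hcirc : ∀ C, M.IsCircuit C → 3 ≤ C.encard)
    (hline : ∀ L ⊆ M.E, M.eRk L = 2 → L.ncard ≤ 3)
    {B : Finset α} (hBE : (B : Set α) ⊆ M.E) (hBq : M.eRk (B : Set α) = (q : ℕ∞)) :
    (B.card - q) * (3 * (B.card - q) - 1) ≤ 2 * ((Matroid.pairsF M q).filter (fun p => p.1 ∪ p.2 ⊆ (B : Set α) ∧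
      (B : Set α) ⊆ M.closure (p.1 ∪ p.2))).card := by
  classical
  refine (card_spanF_ge_tri q hq hcirc hline hBE hBq).trans (Nat.mul_le_mul_left 2 ?_)
  apply Finset.card_le_card_of_surjOn (fun p : Set α × Set α => p.1 ∪ p.2)
  intro D hD
  rw [Finset.mem_coe, mem_spanF] at hD
  obtain ⟨D', hD'B, hD'card, hD'q, hBcl, rfl⟩ := hD
  have hD'E : (D' : Set α) ⊆ M.E := (Finset.coe_subset.2 hD'B).trans hBE
  have hD'ncard : (D' : Set α).ncard = q + 1 := by rw [Set.ncard_coe_finset]; exact hD'card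
  obtain ⟨C, B', hC, hCD, hB'D, hdisj, hcard, hDcl⟩ :=
    Matroid.exists_circuit_extension_exact hD'E hD'q (by rw [hD'ncard]; omega)
  have hCfin : C.Finite := D'.finite_toSet.subset hCD
  have hB'fin : B'.Finite := D'.finite_toSet.subset hB'D
  have hunion_sub : C ∪ B' ⊆ (D' : Set α) := Set.union_subset hCD hB'D
  have hunion_card : (C ∪ B').ncard = q + 1 := by
    rw [Set.ncard_union_eq hdisj.symm hCfin hB'fin]; exact hcard
  have hunion : C ∪ B' = (D' : Set α) :=
    Set.eq_of_subset_of_ncard_le hunion_sub (by rw [hunion_card, hD'ncard]) D'.finite_toSet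
  have hC3 : 3 ≤ C.ncard := by
    have := hcirc C hC
    rw [← hCfin.cast_ncard_eq] at this
    exact_mod_cast this
  have hCle : C.ncard ≤ q + 1 := by omega
  refine ⟨(C, B'), ?_, ?_⟩
  · rw [Finset.mem_coe, Finset.mem_filter]
    refine ⟨?_, ?_, ?_⟩
    · unfold Matroid.pairsF
      rw [Finset.mem_filter]
      refine ⟨?_, hdisj, by show M.eRk (C ∪ B') ≤ q; rw [hunion]; exact hD'q.le⟩
      rw [Finset.mem_biUnion]
      refine ⟨C.ncard, by rw [Finset.mem_Icc]; omega, ?_⟩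
      rw [Finset.mem_product]
      refine ⟨Matroid.mem_circF.2 ⟨hC, rfl⟩, ?_⟩
      apply Matroid.mem_subsF_of
      · rw [Matroid.coe_groundF]; exact hB'D.trans hD'E
      · show B'.ncard = q + 1 - C.ncard
        omega
    · show C ∪ B' ⊆ (B : Set α)
      rw [hunion]; exact_mod_cast hD'B
    · show (B : Set α) ⊆ M.closure (C ∪ B')
      rw [hunion]; exact hBcl
  · exact hunion


end S2

end PercRepro
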